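import Summits.NavierStokesRegularity.FunctionalMining.NoGo.TopEigHeatTwoShell
import HarnessLib

/-!
# NO-GO K42 — TRANSLATION AVERAGING NEVER RAISES `Φ_q`: a DESIGN RULE for kill candidates of
# Lemma L-λ(q) (node K6; static heat line `v + tΔv`, no transport, no pressure)

search for candidate a priori estimates; no regularity claim.

Cell `pub-nsfunc` (NS FUNCTIONAL MINING), NOGO seat (gen 50). A class-level structural statement about
the WITNESS SET of the wanted kill (F2) `¬ TopEigHeatCoercivePos q` of the heat-coercivity lemma L-λ(q)
(`@[conjecture] TopEig.TopEigHeatCoercivePos q`; the tree's `heatDissipation`, `HeatCoerciveOn`).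
Nothing about Navier–Stokes is proved or asserted; no node of the cell is decided (L-λ(q) stays OPEN in
the kernel for every real `q > 1`, FALSE at `q = 1`: K32 `NoGo/TopEigHeatCoerciveOne`).

THE LEVER (every real `q ≥ 1`, both one-sided cores `Φ_q ∈ {∫(λ₁⁺)^q, ∫((−λ₃)⁺)^q}`, any finite `d`).
(1) `Φ_q` is TRANSLATION INVARIANT (`torusTopEigMoment_translate`: the strain of `v(· + a)` is the
    translate of the strain, Haar measure) and CONVEX on smooth fields (`convexOn_topEigMoment_smooth`,
    from the tree's line convexity `TopEig.convexOn_topEigMoment_line`). Hence JENSEN OVER TRANSLATES: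
    **`Φ_q(∑ⱼ θⱼ v(· + aⱼ)) ≤ Φ_q(v)`** for every finite convex combination of translates
    (`topEigMoment_sum_smul_translate_le`).
(2) If `u` is invariant under the translates, `u(· + aⱼ) = u`, then averaging `v = u + w` over them gives
    `u + w̄`, `w̄ = N⁻¹∑ⱼ w(· + aⱼ)`: **`Φ_q(u + w̄) ≤ Φ_q(u + w)`** (`topEigMoment_add_average_le`); and
    if the translates of `w` CANCEL, `∑ⱼ w(· + aⱼ) = 0`, then **`Φ_q(u) ≤ Φ_q(u + w)`**
    (`topEigMoment_le_add_of_sum_translate_eq_zero`) — adding `w` can only RAISE the moment of `u`.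
    The basic instance (`N = 2`): `u(· + h) = u`, `w(· + h) = −w` (`topEigMoment_le_add_of_halfPeriod`).
(3) CONSEQUENCE FOR THE TWO-SHELL KILL MECHANISM of K39 (`NoGo/TopEigHeatTwoShell` (ii): a two-shell
    kill `Δu = −c₁u`, `Δw = −c₂w`, `c₁ < c₂`, at a rate `c ≤ q c₁` NEEDS `Φ_q(u + w) < Φ_q(u)`): if some
    translate fixes the low shell and flips the high shell (more generally: fixes `u` and cancels `w` on
    average), the field `u + w` is heat-coercive at the full low-shell rate,
    **`q c₁ Φ_q(u + w) ≤ heatDissipation Φ_q (u + w)`** (`twoShell_coercive_of_halfPeriod`, class form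
    `heatCoerciveOn_twoShellHalfPeriod_top/negBot`), and is NOT a kill witness at any rate `c ≤ q c₁`
    (`twoShell_not_kill_of_halfPeriod`).
MEANING (instruction (i)/(iii), a typed DESIGN RULE for door-(c)/(F2) candidates, recorded in NOGO.md):
destructive interference between shells must survive every translation symmetry of the low shell — e.g.
on `T³` with `h = (½,½,½)`: a low shell `|k|² = m₁` with all frequencies of even coordinate sum is fixed by
the shift, a high shell with all frequencies of odd coordinate sum is flipped, so EVERY such pair
(`m₁` even-sum lattice shell below an odd-sum shell, any amplitudes and polarisations) is coercive at
`q·4π²m₁` and can never refute L-λ(q) below that rate. Pen rider (not kernel): for a kill one needs the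
support of `ŵ` to meet the coset structure of `⟨supp û⟩`; the healed-chevron designs of SIEVELD (X2C) do.
Sequel: K43 `NoGo/TopEigHeatSignSymmetricShells` (several pieces with INDEPENDENT sign symmetries ⇒ coercive
at the low-shell rate; the cyclic Kolmogorov triple). [ours; Jensen step = Mathlib `ConvexOn.map_sum_le`]
search for candidate a priori estimates; no regularity claim.
FILING (prove seat g29, REQUEST #67): declarations byte-identical to the no-go seat's staged `TopEigHeatTranslationAverage.STAGING.lean` 04251e48b19e107d; this line is the only addition (re-cut from the v2 header-label fix).
-/

noncomputable section

open MeasureTheory Set Filter Topology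

namespace Summit.NavierStokesRegularity.FunctionalMining

open Literature.Analysis.FunctionSpaces Literature.Analysis.FluidPDE

namespace TopEig

variable {d : Type*} [Fintype d] [DecidableEq d]

/-! ## 1. Translation covariance of the strain and invariance of the moments -/

section Translate

variable {F : Type*} [NormedAddCommGroup F] [NormedSpace ℝ F]

omit [Fintype d] in
/-- `∂ᵢ (f(· + a)) (x) = (∂ᵢ f)(x + a)`. [folklore] -/
theorem partialDeriv_translate (f : UnitAddTorus d → F) (a x : UnitAddTorus d) (i : d) :
    Torus.partialDeriv i (fun y => f (y + a)) x = Torus.partialDeriv i f (x + a) := by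
  unfold Torus.partialDeriv Torus.lineDeriv
  exact congrArg (fun g : ℝ → F => deriv g 0) (funext fun t => congrArg f (add_right_comm x _ a))

end Translate

/-- The strain matrix of a translate is the translate of the strain matrix. [folklore] -/
theorem torusStrainMatrix_translate (v : UnitAddTorus d → EuclideanSpace ℝ d) (a x : UnitAddTorus d) :
    torusStrainMatrix (fun y => v (y + a)) x = torusStrainMatrix v (x + a) := by
  ext i j
  simp only [torusStrainMatrix, Matrix.of_apply, partialDeriv_translate]

/-- Equal Hermitian matrices have equal sorted eigenvalues (proof-irrelevance transport). [bookkeeping] -/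
theorem eigenvalues₀_congr {A B : Matrix d d ℝ} (h : A = B) (hA : A.IsHermitian) (hB : B.IsHermitian) :
    hA.eigenvalues₀ = hB.eigenvalues₀ := by
  subst h; rfl

/-- The sorted strain eigenvalues of a translate. [folklore] -/
theorem torusStrainEig_translate (v : UnitAddTorus d → EuclideanSpace ℝ d) (a x : UnitAddTorus d) :
    torusStrainEig (fun y => v (y + a)) x = torusStrainEig v (x + a) :=
  eigenvalues₀_congr (torusStrainMatrix_translate v a x) _ _

/-- `λ₁` of a translate. [folklore] -/
theorem torusStrainTopEig_translate (v : UnitAddTorus d → EuclideanSpace ℝ d) (a x : UnitAddTorus d) :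
    torusStrainTopEig (fun y => v (y + a)) x = torusStrainTopEig v (x + a) := by
  simp only [torusStrainTopEig, torusStrainEig_translate]

/-- `λ_min` of a translate. [folklore] -/
theorem torusStrainBotEig_translate (v : UnitAddTorus d → EuclideanSpace ℝ d) (a x : UnitAddTorus d) :
    torusStrainBotEig (fun y => v (y + a)) x = torusStrainBotEig v (x + a) := by
  simp only [torusStrainBotEig, torusStrainEig_translate]

/-- **`Φ_q = ∫(λ₁⁺)^q` is translation invariant** (Haar measure on the torus). [folklore] -/
theorem torusTopEigMoment_translate (q : ℝ) (v : UnitAddTorus d → EuclideanSpace ℝ d)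
    (a : UnitAddTorus d) : torusTopEigMoment q (fun y => v (y + a)) = torusTopEigMoment q v := by
  simp only [torusTopEigMoment, torusStrainTopEig_translate]
  exact integral_add_right_eq_self (μ := volume) (fun y => (max (torusStrainTopEig v y) 0) ^ q) a

/-- **`∫((−λ₃)⁺)^q` is translation invariant.** [folklore] -/
theorem torusNegBotEigMoment_translate (q : ℝ) (v : UnitAddTorus d → EuclideanSpace ℝ d)
    (a : UnitAddTorus d) : torusNegBotEigMoment q (fun y => v (y + a)) = torusNegBotEigMoment q v := by
  simp only [torusNegBotEigMoment, torusStrainBotEig_translate]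
  exact integral_add_right_eq_self (μ := volume) (fun y => (max (-torusStrainBotEig v y) 0) ^ q) a

/-! ## 2. Convexity on the smooth fields (from the tree's line convexity) -/

omit [Fintype d] [DecidableEq d] in
/-- Chord parametrisation: `x + (a•0 + b•1)•(y − x) = a•x + b•y` when `a + b = 1`. [bookkeeping] -/
private theorem chord_point {x y : UnitAddTorus d → EuclideanSpace ℝ d} {a b : ℝ} (hab : a + b = 1) :
    x + (a • (0 : ℝ) + b • (1 : ℝ)) • (y - x) = a • x + b • y := by
  rw [smul_zero, zero_add, smul_eq_mul, mul_one, smul_sub]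
  calc x + (b • y - b • x) = (a + b) • x + (b • y - b • x) := by rw [hab, one_smul]
    _ = a • x + b • y := by rw [add_smul]; abel

omit [DecidableEq d] in
/-- From convexity along every smooth line to convexity on the smooth set. [bookkeeping] -/
private theorem convexOn_smooth_of_line (Φ : (UnitAddTorus d → EuclideanSpace ℝ d) → ℝ)
    (hline : ∀ {v w : UnitAddTorus d → EuclideanSpace ℝ d}, Torus.IsSmooth v → Torus.IsSmooth w →
      ConvexOn ℝ univ (fun t : ℝ => Φ (v + t • w))) :
    ConvexOn ℝ {v : UnitAddTorus d → EuclideanSpace ℝ d | Torus.IsSmooth v} Φ := by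
  refine ⟨fun x hx y hy a b _ _ _ => (Torus.IsSmooth.smul a hx).add (Torus.IsSmooth.smul b hy), ?_⟩
  intro x hx y hy a b ha hb hab
  have key := (hline hx (hy.sub hx)).2 (mem_univ 0) (mem_univ 1) ha hb hab
  dsimp only at key
  have e0 : x + (0 : ℝ) • (y - x) = x := by rw [zero_smul, add_zero]
  have e1 : x + (1 : ℝ) • (y - x) = y := by rw [one_smul]; abel
  rwa [chord_point hab, e0, e1] at key

/-- **`Φ_q = ∫(λ₁⁺)^q` is convex on the smooth fields**, every real `q ≥ 1`. [ours, calibration] -/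
theorem convexOn_topEigMoment_smooth [Nonempty d] {q : ℝ} (hq : 1 ≤ q) :
    ConvexOn ℝ {v : UnitAddTorus d → EuclideanSpace ℝ d | Torus.IsSmooth v} (torusTopEigMoment q) :=
  convexOn_smooth_of_line _ fun hv hw => convexOn_topEigMoment_line hq hv hw

/-- **`∫((−λ₃)⁺)^q` is convex on the smooth fields**, every real `q ≥ 1`. [ours, calibration] -/
theorem convexOn_negBotEigMoment_smooth [Nonempty d] {q : ℝ} (hq : 1 ≤ q) :
    ConvexOn ℝ {v : UnitAddTorus d → EuclideanSpace ℝ d | Torus.IsSmooth v} (torusNegBotEigMoment q) :=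
  convexOn_smooth_of_line _ fun hv hw => convexOn_negBotEigMoment_line hq hv hw

/-! ## 3. Jensen over translates -/

section Jensen

variable [Nonempty d] {q : ℝ} {ι : Type*}

omit [DecidableEq d] [Nonempty d] in
/-- The abstract step: a translation-invariant functional, convex on the smooth set, does not increase
under convex combinations of translates. [bookkeeping; Mathlib `ConvexOn.map_sum_le`] -/
private theorem map_sum_translate_le (Φ : (UnitAddTorus d → EuclideanSpace ℝ d) → ℝ)
    (hconv : ConvexOn ℝ {v : UnitAddTorus d → EuclideanSpace ℝ d | Torus.IsSmooth v} Φ)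
    (htr : ∀ (v : UnitAddTorus d → EuclideanSpace ℝ d) (a : UnitAddTorus d), Φ (fun y => v (y + a)) = Φ v)
    {v : UnitAddTorus d → EuclideanSpace ℝ d} (hv : Torus.IsSmooth v) (s : Finset ι) (θ : ι → ℝ)
    (a : ι → UnitAddTorus d) (h0 : ∀ j ∈ s, 0 ≤ θ j) (h1 : ∑ j ∈ s, θ j = 1) :
    Φ (∑ j ∈ s, θ j • fun y => v (y + a j)) ≤ Φ v := by
  have h := hconv.map_sum_le h0 h1 (p := fun j => fun y => v (y + a j))
    (fun j _ => (hv.comp_add_right (a j) : Torus.IsSmooth fun y => v (y + a j)))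
  refine h.trans (le_of_eq ?_)
  simp only [smul_eq_mul, htr]
  rw [← Finset.sum_mul, h1, one_mul]

/-- **JENSEN OVER TRANSLATES (`λ₁` core)**: `Φ_q(∑ⱼ θⱼ v(· + aⱼ)) ≤ Φ_q(v)` for smooth `v`, `q ≥ 1`,
`θⱼ ≥ 0`, `∑θⱼ = 1`. [ours, calibration] -/
theorem topEigMoment_sum_smul_translate_le (hq : 1 ≤ q) {v : UnitAddTorus d → EuclideanSpace ℝ d}
    (hv : Torus.IsSmooth v) (s : Finset ι) (θ : ι → ℝ) (a : ι → UnitAddTorus d)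
    (h0 : ∀ j ∈ s, 0 ≤ θ j) (h1 : ∑ j ∈ s, θ j = 1) :
    torusTopEigMoment q (∑ j ∈ s, θ j • fun y => v (y + a j)) ≤ torusTopEigMoment q v :=
  map_sum_translate_le _ (convexOn_topEigMoment_smooth hq) (torusTopEigMoment_translate q) hv s θ a h0 h1

/-- **JENSEN OVER TRANSLATES (`−λ₃` core).** [ours, calibration] -/
theorem negBotEigMoment_sum_smul_translate_le (hq : 1 ≤ q) {v : UnitAddTorus d → EuclideanSpace ℝ d}
    (hv : Torus.IsSmooth v) (s : Finset ι) (θ : ι → ℝ) (a : ι → UnitAddTorus d)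
    (h0 : ∀ j ∈ s, 0 ≤ θ j) (h1 : ∑ j ∈ s, θ j = 1) :
    torusNegBotEigMoment q (∑ j ∈ s, θ j • fun y => v (y + a j)) ≤ torusNegBotEigMoment q v :=
  map_sum_translate_le _ (convexOn_negBotEigMoment_smooth hq) (torusNegBotEigMoment_translate q) hv s θ a
    h0 h1

/-! ## 4. Averaging over a symmetry of `u` -/

omit [Fintype d] [DecidableEq d] [Nonempty d] in
/-- The uniform average of the translates of `u + w` over shifts fixing `u` is `u + w̄`. [bookkeeping] -/
private theorem average_translate_eq {u w : UnitAddTorus d → EuclideanSpace ℝ d} {s : Finset ι}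
    (hs : s.Nonempty) {a : ι → UnitAddTorus d} (hper : ∀ j ∈ s, (fun y => u (y + a j)) = u) :
    (∑ j ∈ s, (s.card : ℝ)⁻¹ • fun y => (u + w) (y + a j)) =
      u + ∑ j ∈ s, (s.card : ℝ)⁻¹ • fun y => w (y + a j) := by
  have hN : (s.card : ℝ) ≠ 0 := by exact_mod_cast hs.card_pos.ne'
  have h2 : ∀ j ∈ s, ((s.card : ℝ)⁻¹ • fun y => (u + w) (y + a j)) =
      (s.card : ℝ)⁻¹ • u + (s.card : ℝ)⁻¹ • fun y => w (y + a j) := by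
    intro j hj
    rw [← smul_add]
    congr 1
    funext y
    have hu := congrFun (hper j hj) y
    simp only [Pi.add_apply] at hu ⊢
    rw [hu]
  rw [Finset.sum_congr rfl h2, Finset.sum_add_distrib, Finset.sum_const, ← Nat.cast_smul_eq_nsmul ℝ,
    smul_smul, mul_inv_cancel₀ hN, one_smul]

omit [DecidableEq d] [Nonempty d] in
/-- The abstract averaging step. [bookkeeping] -/
private theorem add_average_le (Φ : (UnitAddTorus d → EuclideanSpace ℝ d) → ℝ)
    (hJ : ∀ {v : UnitAddTorus d → EuclideanSpace ℝ d}, Torus.IsSmooth v → ∀ (s : Finset ι) (θ : ι → ℝ)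
      (a : ι → UnitAddTorus d), (∀ j ∈ s, 0 ≤ θ j) → ∑ j ∈ s, θ j = 1 →
      Φ (∑ j ∈ s, θ j • fun y => v (y + a j)) ≤ Φ v)
    {u w : UnitAddTorus d → EuclideanSpace ℝ d} (hu : Torus.IsSmooth u) (hw : Torus.IsSmooth w)
    {s : Finset ι} (hs : s.Nonempty) {a : ι → UnitAddTorus d} (hper : ∀ j ∈ s, (fun y => u (y + a j)) = u) :
    Φ (u + ∑ j ∈ s, (s.card : ℝ)⁻¹ • fun y => w (y + a j)) ≤ Φ (u + w) := by
  have hN : (0 : ℝ) < s.card := by exact_mod_cast hs.card_pos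
  have key := hJ (hu.add hw) s (fun _ => (s.card : ℝ)⁻¹) a (fun _ _ => by positivity)
    (by rw [Finset.sum_const, nsmul_eq_mul, mul_inv_cancel₀ hN.ne'])
  rwa [average_translate_eq hs hper] at key

/-- **AVERAGING OVER A SYMMETRY OF `u` (`λ₁` core)**: if `u(· + aⱼ) = u` for all `j ∈ s ≠ ∅` then
`Φ_q(u + w̄) ≤ Φ_q(u + w)`, `w̄ = |s|⁻¹ ∑ⱼ w(· + aⱼ)` (`q ≥ 1`, `u, w` smooth). [ours, calibration] -/
theorem topEigMoment_add_average_le (hq : 1 ≤ q) {u w : UnitAddTorus d → EuclideanSpace ℝ d}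
    (hu : Torus.IsSmooth u) (hw : Torus.IsSmooth w) {s : Finset ι} (hs : s.Nonempty)
    {a : ι → UnitAddTorus d} (hper : ∀ j ∈ s, (fun y => u (y + a j)) = u) :
    torusTopEigMoment q (u + ∑ j ∈ s, (s.card : ℝ)⁻¹ • fun y => w (y + a j)) ≤
      torusTopEigMoment q (u + w) :=
  add_average_le _ (fun hv => topEigMoment_sum_smul_translate_le hq hv) hu hw hs hper

/-- The same for the `−λ₃` core. [ours, calibration] -/
theorem negBotEigMoment_add_average_le (hq : 1 ≤ q) {u w : UnitAddTorus d → EuclideanSpace ℝ d}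
    (hu : Torus.IsSmooth u) (hw : Torus.IsSmooth w) {s : Finset ι} (hs : s.Nonempty)
    {a : ι → UnitAddTorus d} (hper : ∀ j ∈ s, (fun y => u (y + a j)) = u) :
    torusNegBotEigMoment q (u + ∑ j ∈ s, (s.card : ℝ)⁻¹ • fun y => w (y + a j)) ≤
      torusNegBotEigMoment q (u + w) :=
  add_average_le _ (fun hv => negBotEigMoment_sum_smul_translate_le hq hv) hu hw hs hper

/-- **CANCELLING TRANSLATES CAN ONLY RAISE THE MOMENT (both cores)**: if `u(· + aⱼ) = u` (`j ∈ s ≠ ∅`)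
and `∑ⱼ w(· + aⱼ) = 0`, then `Φ_q(u) ≤ Φ_q(u + w)` for `Φ_q ∈ {∫(λ₁⁺)^q, ∫((−λ₃)⁺)^q}`, `q ≥ 1`.
[ours, calibration] -/
theorem topEigMoment_le_add_of_sum_translate_eq_zero (hq : 1 ≤ q)
    {u w : UnitAddTorus d → EuclideanSpace ℝ d} (hu : Torus.IsSmooth u) (hw : Torus.IsSmooth w)
    {s : Finset ι} (hs : s.Nonempty) {a : ι → UnitAddTorus d} (hper : ∀ j ∈ s, (fun y => u (y + a j)) = u)
    (hsum : ∑ j ∈ s, (fun y => w (y + a j)) = 0) :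
    torusTopEigMoment q u ≤ torusTopEigMoment q (u + w) ∧
      torusNegBotEigMoment q u ≤ torusNegBotEigMoment q (u + w) := by
  have e : (u + ∑ j ∈ s, (s.card : ℝ)⁻¹ • fun y => w (y + a j)) = u := by
    rw [← Finset.smul_sum, hsum, smul_zero, add_zero]
  have h1 := topEigMoment_add_average_le hq hu hw hs hper
  have h2 := negBotEigMoment_add_average_le hq hu hw hs hper
  rw [e] at h1 h2
  exact ⟨h1, h2⟩

/-- **THE HALF-PERIOD INSTANCE (both cores)**: if `u(· + h) = u` and `w(· + h) = −w` then
`Φ_q(u) ≤ Φ_q(u + w)` (`q ≥ 1`; average over the two translates `0, h`). [ours, calibration] -/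
theorem topEigMoment_le_add_of_halfPeriod (hq : 1 ≤ q) {u w : UnitAddTorus d → EuclideanSpace ℝ d}
    (hu : Torus.IsSmooth u) (hw : Torus.IsSmooth w) (h : UnitAddTorus d)
    (hper : (fun y => u (y + h)) = u) (hanti : (fun y => w (y + h)) = -w) :
    torusTopEigMoment q u ≤ torusTopEigMoment q (u + w) ∧
      torusNegBotEigMoment q u ≤ torusNegBotEigMoment q (u + w) := by
  refine topEigMoment_le_add_of_sum_translate_eq_zero hq hu hw (s := (Finset.univ : Finset Bool))
    Finset.univ_nonempty (a := fun b => if b then h else 0) (fun b _ => ?_) ?_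
  · cases b
    · funext y; simp
    · simpa using hper
  · rw [Fintype.sum_bool]
    simp only [ite_true]
    rw [hanti]
    funext y; simp

end Jensen

/-! ## 5. Consequence for the two-shell kill mechanism (K39) -/

section TwoShell

variable [Nonempty d] {q c₁ c₂ : ℝ} {u w : UnitAddTorus d → EuclideanSpace ℝ d}

/-- **A SYMMETRIC TWO-SHELL FIELD IS COERCIVE AT THE LOW-SHELL RATE (both cores).** `Δu = −c₁u`,
`Δw = −c₂w`, `c₁ < c₂`, `q ≥ 1`, and a shift `h` with `u(· + h) = u`, `w(· + h) = −w`: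
`q c₁ Φ_q(u + w) ≤ heatDissipation Φ_q (u + w)`. [ours, calibration] -/
theorem twoShell_coercive_of_halfPeriod (hq : 1 ≤ q) (h12 : c₁ < c₂) (hu : Torus.IsSmooth u)
    (hw : Torus.IsSmooth w) (hΔu : Torus.laplacian u = -(c₁ • u)) (hΔw : Torus.laplacian w = -(c₂ • w))
    (h : UnitAddTorus d) (hper : (fun y => u (y + h)) = u) (hanti : (fun y => w (y + h)) = -w) :
    q * c₁ * torusTopEigMoment q (u + w) ≤ heatDissipation (torusTopEigMoment q) (u + w) ∧
      q * c₁ * torusNegBotEigMoment q (u + w) ≤ heatDissipation (torusNegBotEigMoment q) (u + w) := by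
  have hm := topEigMoment_le_add_of_halfPeriod hq hu hw h hper hanti
  have hc := twoShell_coercive_of_moment_le hq h12 hu hw hΔu hΔw
  exact ⟨hc.1 hm.1, hc.2 hm.2⟩

/-- The general symmetric version: shifts `aⱼ` (`j ∈ s ≠ ∅`) fixing `u` whose translates of `w` cancel.
[ours, calibration] -/
theorem twoShell_coercive_of_sum_translate_eq_zero {ι : Type*} (hq : 1 ≤ q) (h12 : c₁ < c₂)
    (hu : Torus.IsSmooth u) (hw : Torus.IsSmooth w) (hΔu : Torus.laplacian u = -(c₁ • u))
    (hΔw : Torus.laplacian w = -(c₂ • w)) {s : Finset ι} (hs : s.Nonempty) {a : ι → UnitAddTorus d}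
    (hper : ∀ j ∈ s, (fun y => u (y + a j)) = u) (hsum : ∑ j ∈ s, (fun y => w (y + a j)) = 0) :
    q * c₁ * torusTopEigMoment q (u + w) ≤ heatDissipation (torusTopEigMoment q) (u + w) ∧
      q * c₁ * torusNegBotEigMoment q (u + w) ≤ heatDissipation (torusNegBotEigMoment q) (u + w) := by
  have hm := topEigMoment_le_add_of_sum_translate_eq_zero hq hu hw hs hper hsum
  have hc := twoShell_coercive_of_moment_le hq h12 hu hw hΔu hΔw
  exact ⟨hc.1 hm.1, hc.2 hm.2⟩

/-- **NO KILL FROM A SYMMETRIC TWO-SHELL PAIR (both cores)**: under the half-period symmetry, `u + w` is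
not a kill witness for L-λ(q) at any rate `c ≤ q c₁`. [ours, calibration] -/
theorem twoShell_not_kill_of_halfPeriod (hq : 1 ≤ q) (h12 : c₁ < c₂) (hu : Torus.IsSmooth u)
    (hw : Torus.IsSmooth w) (hΔu : Torus.laplacian u = -(c₁ • u)) (hΔw : Torus.laplacian w = -(c₂ • w))
    (h : UnitAddTorus d) (hper : (fun y => u (y + h)) = u) (hanti : (fun y => w (y + h)) = -w)
    {c : ℝ} (hc : c ≤ q * c₁) :
    ¬ heatDissipation (torusTopEigMoment q) (u + w) < c * torusTopEigMoment q (u + w) ∧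
      ¬ heatDissipation (torusNegBotEigMoment q) (u + w) < c * torusNegBotEigMoment q (u + w) := by
  have hm := topEigMoment_le_add_of_halfPeriod hq hu hw h hper hanti
  have hk := twoShell_moment_lt_of_kill hq h12 hu hw hΔu hΔw hc
  exact ⟨fun hlt => absurd (hk.1 hlt).2 (not_lt.mpr hm.1), fun hlt => absurd (hk.2 hlt).2 (not_lt.mpr hm.2)⟩

end TwoShell

/-! ## 6. The class statements -/

/-- **The half-period-symmetric two-shell class is heat-coercive at the low-shell rate (`λ₁` core)**:
for every real `q ≥ 1` and `c₁`, `HeatCoerciveOn {u + w : Δu = −c₁u, Δw = −c₂w, c₁ < c₂, ∃ h,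
u(· + h) = u ∧ w(· + h) = −w} (∫(λ₁⁺)^q) (q c₁)`. [ours, calibration] -/
theorem heatCoerciveOn_twoShellHalfPeriod_top [Nonempty d] {q : ℝ} (hq : 1 ≤ q) (c₁ : ℝ) :
    HeatCoerciveOn
      (fun v : UnitAddTorus d → EuclideanSpace ℝ d =>
        ∃ (u w : UnitAddTorus d → EuclideanSpace ℝ d) (c₂ : ℝ) (h : UnitAddTorus d),
          Torus.IsSmooth u ∧ Torus.IsSmooth w ∧ Torus.laplacian u = -(c₁ • u) ∧
          Torus.laplacian w = -(c₂ • w) ∧ c₁ < c₂ ∧ v = u + w ∧ (fun y => u (y + h)) = u ∧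
          (fun y => w (y + h)) = -w)
      (torusTopEigMoment q) (q * c₁) := by
  rintro - v - - - ⟨u, w, c₂, h, hu, hw, hΔu, hΔw, h12, rfl, hper, hanti⟩
  exact (twoShell_coercive_of_halfPeriod hq h12 hu hw hΔu hΔw h hper hanti).1

/-- The same for the `−λ₃` core. [ours, calibration] -/
theorem heatCoerciveOn_twoShellHalfPeriod_negBot [Nonempty d] {q : ℝ} (hq : 1 ≤ q) (c₁ : ℝ) :
    HeatCoerciveOn
      (fun v : UnitAddTorus d → EuclideanSpace ℝ d =>
        ∃ (u w : UnitAddTorus d → EuclideanSpace ℝ d) (c₂ : ℝ) (h : UnitAddTorus d),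
          Torus.IsSmooth u ∧ Torus.IsSmooth w ∧ Torus.laplacian u = -(c₁ • u) ∧
          Torus.laplacian w = -(c₂ • w) ∧ c₁ < c₂ ∧ v = u + w ∧ (fun y => u (y + h)) = u ∧
          (fun y => w (y + h)) = -w)
      (torusNegBotEigMoment q) (q * c₁) := by
  rintro - v - - - ⟨u, w, c₂, h, hu, hw, hΔu, hΔw, h12, rfl, hper, hanti⟩
  exact (twoShell_coercive_of_halfPeriod hq h12 hu hw hΔu hΔw h hper hanti).2

end TopEig

end Summit.NavierStokesRegularity.FunctionalMining

end
-- search for candidate a priori estimates; no regularity claim
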